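import Mathlib
import HarnessLib
import HarnessLib.Audit
import Summits.QuantumFields.Statement

/-!
Route: GradientFlowSpecies

# Route GradientFlowSpecies — renormalise by the Wilson flow — flowed fields give the existence half
of QCDOf on a class of calibrations; the gap is imported on the same class

It suffices to show X = X_UV ∧ X_IR over ONE interface predicate. Call a mass-independent
regularisation `reg : QCDRegularisation N_f` an EXISTENCE-HALF CALIBRATION (class 𝒞) when
`reg.HasMassScaling` and, for every tuple `m > 0`, some species renormalisations `z, shift` and OS
data `T` satisfy `IsQCDAlong (reg.scheme m z shift) T`, `T.IsNontrivial glue`, `T.IsNonGaussian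
glue` and `T.IsNontrivial (pseudoRe f g)` for all `f ≠ g` — every clause of `QCDOf N_f` except the
gap. X_UV (crux FlowedExistenceHalf, the deliverable of card gradient-flow-species): for `N_f = 2,
3` the class 𝒞 is non-empty — to be inhabited by the FLOW CALIBRATION (`m_crit(k)` := zero of the
flowed PCAC mass, `Z_m(k)` := flowed-PCAC mass renormalisation, `z_glue` := small-flow-time
matching), whose flowed correlators converge and obey a `k`-uniform small-flow-time expansion. X_IR
(crux MassiveLatticeGap, imported infrared half): every `reg ∈ 𝒞` has, above some mass threshold
`M`, a uniform lattice gap `(reg.scheme m 0 0).HasLatticeMassGap Δ(m)`, `Δ(m) > 0`. X → QCD by the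
offset trick (shifting `m_crit` by `a_k M⁺/Z_m(k)` maps 𝒞 to 𝒞 and realises masses `m + M⁺`; support
OffsetShift) and the transfer "uniform lattice gap + convergence ⇒ continuum gap" (support
GapTransfer). The flow engine's first quantitative test is filed separately as crux
FlowedEnergyUVBound (typed with the lattice flow ODE inlined) and its deterministic half as support
LatticeFlowEpsilonRegularity.
Lean: `(∀ Nf : ℕ, Nf = 2 ∨ Nf = 3 → ∃ reg :
Literature.MathematicalPhysics.QuantumFieldTheory.QCDRegularisation Nf, reg.HasMassScaling ∧ ∀ m :
Fin Nf → ℝ, (∀ f, 0 < m f) → ∃ (z shift : Literature.MathematicalPhysics.QuantumFieldTheory.QCDField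
Nf → ℕ → ℝ) (T : Literature.MathematicalPhysics.QuantumFieldTheory.OSData
(Literature.MathematicalPhysics.QuantumFieldTheory.QCDField Nf) 4),
Literature.MathematicalPhysics.QuantumFieldTheory.IsQCDAlong (reg.scheme m z shift) T ∧
T.IsNontrivial Literature.MathematicalPhysics.QuantumFieldTheory.QCDField.glue ∧ T.IsNonGaussian
Literature.MathematicalPhysics.QuantumFieldTheory.QCDField.glue ∧ ∀ f g : Fin Nf, f ≠ g →
T.IsNontrivial (Literature.MathematicalPhysics.QuantumFieldTheory.QCDField.pseudoRe f g)) ∧ (∀ Nf :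
ℕ, Nf = 2 ∨ Nf = 3 → ∀ reg : Literature.MathematicalPhysics.QuantumFieldTheory.QCDRegularisation Nf,
(reg.HasMassScaling ∧ ∀ m : Fin Nf → ℝ, (∀ f, 0 < m f) → ∃ (z shift :
Literature.MathematicalPhysics.QuantumFieldTheory.QCDField Nf → ℕ → ℝ) (T :
Literature.MathematicalPhysics.QuantumFieldTheory.OSData
(Literature.MathematicalPhysics.QuantumFieldTheory.QCDField Nf) 4),
Literature.MathematicalPhysics.QuantumFieldTheory.IsQCDAlong (reg.scheme m z shift) T ∧
T.IsNontrivial Literature.MathematicalPhysics.QuantumFieldTheory.QCDField.glue ∧ T.IsNonGaussian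
Literature.MathematicalPhysics.QuantumFieldTheory.QCDField.glue ∧ ∀ f g : Fin Nf, f ≠ g →
T.IsNontrivial (Literature.MathematicalPhysics.QuantumFieldTheory.QCDField.pseudoRe f g)) → ∃ M : ℝ,
∀ m : Fin Nf → ℝ, (∀ f, M < m f) → ∃ Δ : ℝ, 0 < Δ ∧ (reg.scheme m 0 0).HasLatticeMassGap Δ)`

## Assembly
Fix N_f ∈ {2, 3}. FlowedExistenceHalf gives reg ∈ 𝒞; MassiveLatticeGap gives its threshold M; put M⁺
= max M 0 + 1 and reg' := reg with m_crit(k) ↦ m_crit(k) + a_k M⁺/Z_m(k). By OffsetShift,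
reg'.scheme m z shift = reg.scheme (m + M⁺) z shift, so reg' inherits HasMassScaling and, for every
m > 0, the witnesses (z, shift, T) of reg at m + M⁺ > M⁺ > M, together with a lattice gap Δ > 0 of
reg.scheme (m + M⁺) 0 0 — whose HasLatticeMassGap depends only on (a, β, L, bare masses), identical
to those of reg'.scheme m z shift. GapTransfer turns it into T.HasMassGap (Δ/2); HasLatticeMassGap
is monotone in Δ, so Δ/2 serves both clauses: QCDOf N_f. Both N_f give QCD = QCDOf 2 ∧ QCDOf 3.
Standard reductions only (structure bookkeeping, monotonicity of the exponential bound).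

Rationale: WHY THIS LINE. Mechanism (card gradient-flow-species): Lüscher's Wilson/gradient flow `V̇_t =
−g₀²(∂S_W)(V_t)V_t` (Luscher2010 §1) is a deterministic, gauge-covariant heat semigroup on lattice
gauge fields; composite fields at positive flow time need NO operator renormalisation to all orders
(LuscherWeisz2011; `⟨E⟩ = 3(N²−1)ḡ²/(128π²t²)(1+…)` "does not need to be renormalized", Luscher2010
§2.6), flowed quark densities renormalise multiplicatively with no power-divergent mixing and obey
exact chiral Ward identities (Luscher2013 §§2–4), and local fields are recovered by the
small-flow-time expansion (Suzuki2013). The route uses this to DEFINE the audited statement's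
witness data non-perturbatively (`m_crit` = zero of the flowed PCAC mass — evading the
linear-divergence renormalon; `Z_m` from flowed PCAC, whose leading log is `γ₀/(2β₀)` =
`HasMassScaling`; `z_glue` by small-`t` matching, which also removes the `a⁻¹ψ̄ψ` mixing flagged in
the Statement docstring) and to split existence into (flowed-correlator limit) + (`k`-uniform
small-`t` remainder). Imported areas: geometric-analysis regularity theory of the Yang–Mills heat
flow (Hamilton1993 monotonicity, ChenShen1994 ε-regularity, Struwe1994, Waldron2019; rigorous
heat-flow regularisation of rough gauge fields CharalambousGross2012, Gross2021, CaoChatterjee2021)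
for the deterministic half; constructive multiscale analysis (Balaban1989LargeFieldII) for the
`k`-uniform half; OS reconstruction / transfer matrix (OsterwalderSeiler1978, Luscher1977,
GlimmJaffe1987) for the assembly. What it does that no prior route does: there is no QCD route;
relative to the block-spin cards (heavy-threshold-robust-ym-bridge, threshold-window-bridge) it
needs no block map on measures, no gauge fixing (NeubergerZeroOverZero n/a) and defines `m_crit,
Z_m` through flowed Ward identities instead of implicit-function tuning; relative to the physics
GFERG programme (SonodaSuzuki2021) the flow here calibrates a constructive witness, not a Wilson
action. Negatives index: empty at filing.

RANKED CRUXES. #2 FlowedExistenceHalf (crux) — For N_f = 2 and N_f = 3 the class 𝒞 of existence-half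
calibrations is non-empty: there is a mass-independent lattice regularisation reg (spacings a_k → 0,
AF bare couplings, volumes a_kL_k → ∞, flavour-blind m_crit(k), Z_m(k) > 0) with reg.HasMassScaling
such that for EVERY tuple of renormalised masses m_f > 0 there are species renormalisations z, shift
and OS data T with IsQCDAlong (reg.scheme m z shift) T, T.IsNontrivial glue, T.IsNonGaussian glue
and T.IsNontrivial (pseudoRe f g) for all f ≠ g (card items D1–D4: the intended witness is the FLOW
calibration — m_crit(k) = zero of the flowed PCAC mass at flow time t_k with a_k² ≪ t_k → 0, Z_m(k)
= flowed-PCAC mass renormalisation, z_glue(k) = 1/c_E(t_k) small-flow-time matching — proved via the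
foreseen children FlowCalibration (flowed correlators converge, k-uniform small-flow-time expansion)
→ FlowRealisation; see Two-layer plan). [difficulty: open-problem] (why it might fail: E1
(rotations) of the limit must come from the k-uniform small-t expansion, an OPE-type theorem known
only perturbatively (Hollands–Kopper); k-uniformity between a_k and √t is Balaban-class with
fermions, never done; N_f = 3 needs signed-determinant control.) [Luscher2010, LuscherWeisz2011,
Luscher2013, Suzuki2013, Balaban1989LargeFieldII, OsterwalderSeiler1978, MontvayMunster1994]
#3 FlowedEnergyUVBound (crux) — (The engine's first quantitative test, positive-measure core, flow
ODE inlined.) For two DEGENERATE Wilson flavours (det² ≥ 0: honest probability measure) along ANY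
sequential scheme with two-loop asymptotic scaling of β_k and bare mass eventually > −1, and for
every physical flow time t > 0, the flowed lattice action density at lattice flow time t/a_k² is
O(a_k⁴) uniformly in k: there is C(t) with |⟨Σ_{μ<ν}(3 − Re tr V_{t/a_k²}(p_{0,μν}))⟩_k| ≤ C(t)·a_k⁴
for all large k, where V_s = B s U is any solution of Lüscher's lattice flow V̇(x,μ) =
−P_{su(3)}(Ω_{x,μ}(V))V(x,μ), V₀ = U (Ω = sum of the six plaquette holonomies through the link
starting with V(x,μ), P(W) = ½(W−Wᴴ) − ⅙tr(W−Wᴴ)). Physically: t²⟨E_t⟩ stays bounded as the cutoff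
is removed — the k-uniform tightness that makes flowed continuum limits non-degenerate at the
canonical scaling (perturbatively t²⟨E⟩ = 3(N²−1)ḡ²(q)/(128π²), q = (8t)^(−1/2), Luscher2010 §2.6).
[difficulty: XL] (why it might fail: it is UV stability in flow language: configurations whose flow
stalls must be a⁻⁴-rare (centre-valued links are exact stationary points, cost 27β ≈ a^6.6: fine; a
cheaper stable lattice saddle, action < 1/b₀ ≈ 16, breaks it); no k-uniform bound exists beyond
Balaban's pure-YM effective actions.) [Luscher2010, LuscherWeisz2011, Balaban1989LargeFieldII,
Luscher1982Topology, ChenShen1994]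
#4 MassiveLatticeGap (crux) — (Imported infrared half, heavy-threshold form on the interface class.)
For N_f = 2, 3 and every existence-half calibration reg ∈ 𝒞 (hypothesis = the matrix of
FlowedExistenceHalf for this reg) there is a threshold M such that for every mass tuple with all m_f
> M the lattice theory at the scheme's own couplings β_k and bare masses m_crit(k) + a_k m_f/Z_m(k)
has a uniform full-spectrum lattice gap: ∃ Δ > 0, (reg.scheme m 0 0).HasLatticeMassGap Δ (all
gauge-invariant local lattice QCD observables, uniformly in the volume). Membership in 𝒞 pins m_crit
to the true critical region up to a bounded physical offset (dynamical quarks for all m > 0 exclude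
cutoff-scale offsets), so above threshold all quarks are heavy relative to Λ and the content is
"Yang–Mills lattice gap + decoupling" — the companion cards' business
(heavy-threshold-robust-ym-bridge), deliberately ranked last here. [deps: FlowedExistenceHalf]
[difficulty: open-problem] (why it might fail: contains the Yang–Mills lattice mass gap
(PerturbativeInvisibility: no expansion in g sees it) plus non-perturbative heavy-quark decoupling;
a calibration in 𝒞 parked in an exotic Wilson phase (Aoki/negative-mass side, SharpeSingleton1998)
for infinitely many k would need the threshold to absorb it.) [JaffeWitten2000, SharpeSingleton1998,
AppelquistCarazzone1975, Weingarten1983, OsterwalderSeiler1978, Seiler1982]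
#9 GapTransfer (support) — Uniform lattice gap + convergence ⇒ continuum gap: if IsQCDAlong sch T
and sch.HasLatticeMassGap Δ then T.HasMassGap Δ' for every 0 < Δ' < Δ. Route: at fixed k let the
time extent S → ∞ (allowed by HasLatticeMassGap's volume-uniformity) and read the pairwise bounds
spectrally through Lüscher's positive transfer matrix for Wilson fermions (m_f(k) > −1): every
vector ÂΩ has spectral measure in {1} ∪ [0, e^(−aΔ)], these span the physical space, hence ‖Tⁿ −
P_Ω‖ ≤ e^(−aΔn) with constant 1; apply to time-ordered products of smeared species fields (constants
= norms = reflection-positive 2n-point functions, convergent by IsQCDAlong), pass k → ∞, extend from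
product tensors by E0' linear growth. Glue, but with two honest gaps: finite-torus (−1)^F-twisted
trace vs vacuum expectation at fixed k, and S → ∞ before k → ∞. [difficulty: M] [Luscher1977,
OsterwalderSeiler1978, GlimmJaffe1987, Seiler1982]
#9 OffsetShift (support) — The offset trick used by the Assembly: shifting the critical mass of a
regularisation by a_k·M/Z_m(k) realises the mass tuple m as the original regularisation realises m +
M (definitional: both schemes have bare masses m_crit(k) + a_k(m_f + M)/Z_m(k); HasMassScaling is
untouched since Z_m is). Provable now (structure eta + ring). [difficulty: provable-now]
[MontvayMunster1994]
#9 LatticeFlowEpsilonRegularity (support) — (Deterministic half of FlowedEnergyUVBound: lattice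
ε-regularity for the Wilson flow, uniform in the flow time.) There are ε₀ > 0 and C such that on
every torus (ℤ/S)⁴, for every solution B of Lüscher's lattice flow ODE (inlined as in
FlowedEnergyUVBound), every configuration U, site x, plane (μ,ν) and lattice flow time 1 ≤ t ≤
S²/64: if the Gaussian-weighted plaquette action at scale √t, Ψ(x,t,U) = Σ_p exp(−dist(x,p)²/4t)(3 −
Re tr U_p) (torus distance), is ≤ ε₀, then the flowed plaquette at x obeys 3 − Re tr (B_t
U)_p(x;μ,ν) ≤ C/t². Continuum model: Hamilton's monotonicity of the Gaussian-weighted Yang–Mills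
energy in d = 4 + Chen–Shen small-action regularity; applied at time t/2 → t to already-flowed
fields it converts "small flowed action density with high probability" into pointwise O(a⁴) bounds.
A linear refinement (≤ C·Ψ/t²) is expected but not filed. [difficulty: L] [Hamilton1993,
ChenShen1994, Struwe1994, Waldron2019, Luscher2010]

TWO-LAYER PLAN. FlowedExistenceHalf ⇐ FlowCalibration → FlowRealisation → FlowedExistenceHalf (k =
2), to be filed once the definitions wilsonFlow / fermionFlow land: FlowCalibration = "∃ reg (any AF
data a, β, L; m_crit, Z_m from the flowed PCAC Ward identity at t_k = a_k^(2(1−δ))) such that for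
every m > 0 all flowed gauge and quark-bilinear correlators converge as k → ∞ at fixed physical flow
times (FlowedLimit, card D1) and the small-flow-time expansion of flowed 2- and 3-point functions at
separated points holds with remainder O(t·dist⁻²) uniform in k and coefficients c_E, c_P from
renormalised perturbation theory in ḡ(1/√8t) (UniformSmallFlowTime, card D2)"; FlowRealisation = "∀
reg, FlowedLimit → UniformSmallFlowTime → reg ∈ 𝒞" (OS data reconstructed from the unflowed limits
delivered by the expansion; E2 from lattice RP, E1 from O(4)-restoration in the expansion,
non-Gaussianity of glue and non-decoupling of pseudoRe f g from flowed short-distance 3- /2-point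
asymptotics, HasMassScaling from the leading log of c_P). FlowedEnergyUVBound ⇐
LatticeFlowEpsilonRegularity (filed) → SmearedActionLargeDeviation ("flowed Gaussian-weighted action
at time t/2a_k² exceeds ε₀ with probability ≤ C a_k⁴", the measure-theoretic UV-stability input) →
FlowedEnergyUVBound. MassiveLatticeGap ⇐ CalibrationOffsetBound (𝒞-membership ⇒ bounded physical
offset of m_crit) → HeavyQuarkYMGap (companion routes) → MassiveLatticeGap.

KILL CRITERIA. Refutation of FlowedExistenceHalf (e.g. a theorem that no OS data with E1 can be a
Wilson-fermion lattice limit along AF scaling, or that HasMassScaling is unrealisable) closes the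
route `refuted:FlowedExistenceHalf` and with it every existence route through 𝒞. Refutation of
FlowedEnergyUVBound (a lattice saddle family of action < 1/b₀ ≈ 16 stable under the flow with
density ≫ a⁴, or numerics showing t²⟨E_t⟩ growing with the cutoff at fixed t) kills the flow ENGINE:
pivot FlowedExistenceHalf's plan to block-spin children (merge with
heavy-threshold-robust-ym-bridge) or close `refuted:FlowedEnergyUVBound` if no engine remains.
Refutation of MassiveLatticeGap by an exotic calibration in 𝒞 forces a pivot to a restated X_IR with
an explicit calibration hypothesis (restate, not close); refutation by "no lattice gap at heavy
masses" refutes QCD-as-rendered for everyone. A proof elsewhere of QCDOf 2 ∧ QCDOf 3 moots the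
route; a proof of the YM lattice gap + decoupling elsewhere closes MassiveLatticeGap's branch for
free.

NOT DECOMPOSED YET. The flow-specific children of FlowedExistenceHalf (FlowedLimit,
UniformSmallFlowTime, FlowRealisation) wait for the definitions wilsonFlow (gauge) and fermionFlow
(Lüscher 2013) — requested at open; until then the flow appears typed only inside
FlowedEnergyUVBound / LatticeFlowEpsilonRegularity (ODE inlined). Not decomposed: the perturbative
coefficient facts (c_E to three loops, c_P leading log = γ₀/(2β₀)) as cite items; the N_f = 3
signed-determinant control (WilsonDeterminantSign) inside FlowCalibration; the S → ∞ / twisted-trace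
bookkeeping inside GapTransfer; the linear (≤ CΨ/t²) form of ε-regularity; the calibration-offset
lemma and the YM-gap/decoupling split of MassiveLatticeGap (owned by companion routes); any
femto-universe (fixed physical volume) milestone version of FlowedLimit.

CHEAPEST FALSIFIER. (i) Pencil, one page: write the flow equation for ⟨E_t(x)E_t(y)⟩ and check
whether the hierarchy closes at finite order with the pathwise bounds available on the lattice (|Re
tr V_p| ≤ 3 only) — if uniqueness-from-hierarchy is empty, FlowCalibration must identify limits
another way (the route survives on subsequences, UVStabilityNonUniqueness conceded). (ii) kit job
(not run: plancard seat, kit not in payload): SU(3) pure-gauge or N_f = 2 Wilson ensembles at β =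
5.96/6.17/6.42, measure t²⟨E_t⟩ at fixed t/t₀ across a factor 2.5 in a — public lattice data
(Lüscher 2010 Fig. 1; t₀ scale setting) already show it FLAT to percent level, so
FlowedEnergyUVBound passes its numerical test; a refuter should instead flow random
centre-vortex/dislocation seeds and look for stalled configurations of action < 16. (iii) Lookup: is
a lattice ε-regularity/monotonicity formula for the Wilson flow in print (it is not in Luscher2010,
LuscherWeisz2011; continuum: Hamilton1993, ChenShen1994)? If yes, LatticeFlowEpsilonRegularity is
`known`.

NUMBERS. ⟨E⟩ = 3(N²−1)ḡ²(q)/(128π²t²)(1 + c̄₁ḡ² + …), q = (8t)^(−1/2), smoothing radius √(8t)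
(Luscher2010 §2); b₀ = (11 − 2N_f/3)/(16π²) (tree betaCoeff₀; 0.0612 for N_f = 2, 0.0570 for N_f =
3), γ₀/(2β₀) = 12/(33 − 2N_f) (tree massExponent; 4/9 at N_f = 3); tree normalisation β = 2/g₀²
multiplies Σ_p(3 − Re tr U_p), so a configuration of excess action ΔS has density ∼ (aΛ)^(2b₀·2ΔS·…)
— a centre-valued link (ΔS = 27) is suppressed like a^6.6 (N_f = 2), the a⁴ threshold is ΔS = 1/b₀ ≈
16.3, a continuum instanton has ΔS = 4π² ≈ 39.5. Items at open: 7 (3 cruxes, 3 support, 1 assembly).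

DEFINITION REQUESTS. (1) `wilsonFlow` (Literature/MathematicalPhysics/QuantumFieldTheory, next to
GaugeConfig/wilsonAction): the lattice gradient flow of the Wilson action on GaugeConfig d L
(specialUnitaryGroup n ℂ) — global existence/uniqueness of V̇(x,μ) = −P_{su(n)}(Ω_{x,μ}(V))V(x,μ),
V₀ = U; semigroup; gauge and lattice-symmetry covariance; continuity/measurability in U; S_W(V_t) ≤
S_W(U) (Luscher2010 §1). Once landed, FlowedEnergyUVBound / LatticeFlowEpsilonRegularity can be
restated over it (same meaning) and the children of FlowedExistenceHalf filed. (2) `fermionFlow`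
(same topic or QuantumLattice next to wilsonDirac): Lüscher's quark flow χ̇ = Δ[V_t]χ as a
V-dependent linear map on Grassmann generator coefficients, flowed bilinears χ̄_tΓχ_t, flowed PCAC
mass (Luscher2013 §§2–3). (3) cite facts wanted later (not now): LuscherWeisz2011 all-orders
renormalisability; Suzuki2013 small-flow-time coefficients; Harlander–Neumann 2016 (c_E to three
loops).

Novelty: Searches (2026-08-15): `lit frontier QuantumFields --since 2020` (30 rows: stochastic-quantisation /
Langevin papers use the NOISY flow in d = 2, 3; arXiv:2401.10507 YM–Higgs scaling limit; nothing
uses the deterministic flow as a renormalisation scheme for a constructive limit); `lit bridges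
QuantumFields --cross any` (30 rows, percolation/Ising bridges only); `lit galaxy search "Wilson
flow" --star all` (40 rows: lattice numerics/perturbation theory — Harlander–Neumann 3-loop flow,
arXiv:1302.5246, master-field QCD; no rigorous item); `lit galaxy search "Yang-Mills heat equation"
--star all` (9 rows: Struwe1994, Feehan Morse theory, Kelleher thesis); `lit galaxy search "small
flow-time expansion" --star all` (1 row, QCD viscosity numerics); `lit search "Yang-Mills heat
equation gauge fields regularization Charalambous Gross"` (Charalambous–Gross CMP 2012 / JMP 2015 /
JMAA 2017, Gross Memoirs 2021); `lit search --source arxiv "gradient flow renormalization group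
lattice gauge theory" --year-from 2012` (20 rows: GFERG SonodaSuzuki2021, arXiv:2506.23567,
arXiv:2508.16828; Makino–Morikawa–Suzuki arXiv:1802.07897; Carosso–Hasenfratz–Neil arXiv:1806.01385
— all physics-level); `lit search --source crossref "monotonicity formula small action regularity
Yang-Mills flow"` (ChenShen1994, Hamilton1993, Naito 1994 blow-up in d ≥ 5); `ledger negatives
--problem QuantumFields` (0); barrier files UVStabilityNonUniqueness,
StochasticQuantisationCriticality, RegularisationDichotomy, AokiPha  [refs: 2401.10507, 1302.5246, 2506.23567, 2508.16828, 1802.07897, 1806.01385, Struwe1994, SonodaSuzuki2021, ChenShen1994, Hamilton1993, Luscher2010, LuscherWeisz2011, Luscher2013, Suzuki2013, CharalambousGross2012, Gross2021, CaoChatterjee2021, Waldron2019]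

Barriers (technique_class: gradient-flow-renormalisation, sft-ope): - technique_class: gradient-flow-renormalisation, sft-ope
- Literature.Barriers.QuantumFields.UVStabilityNonUniqueness: conceded in part — FlowedEnergyUVBound
IS a UV-stability statement (in flow language, for one observable family); the bet is that the
flow's t-identities (flow hierarchy / small-t expansion with perturbatively fixed coefficients)
identify subsequential limits, and IsQCDAlong (ruling Y2) accepts a sequence anyway.
- Literature.Barriers.QuantumFields.StochasticQuantisationCriticality: not in class — the flow is
deterministic (no white noise, no regularity structure), applied configuration-wise at fixed
spacing; criticality of the d = 4 SPDE is irrelevant; the price is that the flow builds no measure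
(MassiveLatticeGap imported).
- Literature.Barriers.QuantumFields.RegularisationDichotomy: the lattice keeps RP (E2 for free), E1
must be recovered in the limit — here from the k-uniform small-flow-time expansion whose
coefficients are O(4)-invariant; honest open point recorded in FlowedExistenceHalf's why-might-fail.
- Literature.Barriers.QuantumFields.LinearDivergenceRenormalon: evaded — m_crit(k) is defined
non-perturbatively as the zero of the flowed PCAC mass (no power-divergent series summed); the
residual O(aΛ) flavour-blind ambiguity is exactly the statement's free offset M₀, which the
Assembly's offset trick exploits rather than fights.
- Literature.Barriers.QuantumFields.AokiPhaseDichotomy: not entered — the statement (audit g7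
reading) never demands the

sub-problem: QCD · status: done · opened planner-plancard-QuantumFields-QCD-gradient-f-c9df0611-0 2026-08-15T13:43:24Z · rev 2 · ledger route-QuantumFields-GradientFlowSpecies
GENERATED by the gate from the ledger (D-0016/17). Provers cite these decls: `theorem foo : Summit.QuantumFields.QCD.Theses.GradientFlowSpecies.<Decl> := …` in Summits/QuantumFields/QCD/Theorems/<Name>.lean.
-/

namespace Summit.QuantumFields.QCD.Theses.GradientFlowSpecies

open scoped BigOperators Topology Manifold Classical MeasureTheory ProbabilityTheory Matrix InnerProductSpace ComplexConjugate ContinuousMap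
open Filter Set Function TopologicalSpace MeasureTheory

attribute [summit_statement] _root_.QCD

/-- item stmt-QuantumFields-8870 · crux · rank 2 · open · by planner
why it might fail: OS data with E1, E4 from Wilson fermions need k-uniform multiscale control with fermions, undone beyond Balaban's pure-YM UV stability; E1 only via small-flow-time/OPE expansion known perturbatively (1105.3375); ∃reg ∀m ∃T: ONE sequence for uncountably many m, no diagonal subsequence; N_f=3 det sign
sources: Luscher2010, LuscherWeisz2011, Luscher2013, Suzuki2013, Balaban1989LargeFieldII, OsterwalderSeiler1978
[target] X₀ — for N_f = 2 and N_f = 3 there is a mass-independent `QCDRegularisation` with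
`HasMassScaling` such that for every tuple of positive renormalised masses some species
renormalisations and OS data T satisfy `IsQCDAlong` (AF Wilson scheme, sequential continuum limit),
with non-trivial non-Gaussian glue and every flavour-changing pseudoscalar non-trivial: `QCDOf`
without its two gap clauses; the deliverable of the engine (cruxes 2–4). -/
@[route_item "route-QuantumFields-GradientFlowSpecies"]
def FlowedExistenceHalf : Prop :=
  ∀ Nf : ℕ, Nf = 2 ∨ Nf = 3 → ∃ reg : Literature.MathematicalPhysics.QuantumFieldTheory.QCDRegularisation Nf, reg.HasMassScaling ∧ ∀ m : Fin Nf → ℝ, (∀ f, 0 < m f) → ∃ (z shift : Literature.MathematicalPhysics.QuantumFieldTheory.QCDField Nf → ℕ → ℝ) (T : Literature.MathematicalPhysics.QuantumFieldTheory.OSData (Literature.MathematicalPhysics.QuantumFieldTheory.QCDField Nf) 4), Literature.MathematicalPhysics.QuantumFieldTheory.IsQCDAlong (reg.scheme m z shift) T ∧ T.IsNontrivial Literature.MathematicalPhysics.QuantumFieldTheory.QCDField.glue ∧ T.IsNonGaussian Literature.MathematicalPhysics.QuantumFieldTheory.QCDField.glue ∧ ∀ f g : Fin Nf, f ≠ g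 → T.IsNontrivial (Literature.MathematicalPhysics.QuantumFieldTheory.QCDField.pseudoRe f g)

/-- item stmt-QuantumFields-8921 · crux · rank 3 · open · by planner
why it might fail: As typed any bare mass > −1 qualifies, e.g. mq≡5: pure-YM dynamics (b₀=11/16π²) but a_k follows afBeta(N_f=2), a_true/a_k ≍ (a_kΛ)^(−4/33) → ∞, so O(a_k⁴) needs sup_T T²⟨E_T⟩<∞ in YM; flow keeps Q, χ_t>0, E ≥ 8π²|q| ⇒ T²⟨E_T⟩ ≳ √χ_t·T (data ∝ t: 1203.4469 p.4). Tuned masses: unproved UV stability.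
sources: Luscher2010, arXiv:1203.4469, arXiv:1506.06052, BrunoEtAl2015HeavySea, AppelquistCarazzone1975, Balaban1989LargeFieldII
[crux] (The engine's first quantitative test, positive-measure core, flow ODE inlined.) For two
DEGENERATE Wilson flavours (det² ≥ 0: honest probability measure) along ANY sequential scheme with
two-loop asymptotic scaling of β_k and bare mass eventually > −1, and for every physical flow time t
> 0, the flowed lattice action density at lattice flow time t/a_k² is O(a_k⁴) uniformly in k: there
is C(t) with |⟨Σ_{μ<ν}(3 − Re tr V_{t/a_k²}(p_{0,μν}))⟩_k| ≤ C(t)·a_k⁴ for all large k, where V_s =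
B s U is any solution of Lüscher's lattice flow V̇(x,μ) = −P_{su(3)}(Ω_{x,μ}(V))V(x,μ), V₀ = U (Ω =
sum of the six plaquette holonomies through the link starting with V(x,μ), P(W) = ½(W−Wᴴ) −
⅙tr(W−Wᴴ)). Physically: t²⟨E_t⟩ stays bounded as the cutoff is removed — the k-uniform tightness
that makes flowed continuum limits non-degenerate at the canonical scaling (perturbatively t²⟨E⟩ =
3(N²−1)ḡ²(q)/(128π²), q = (8t)^(−1/2), Luscher2010 §2.6). [difficulty: XL] -/
@[route_item "route-QuantumFields-GradientFlowSpecies"]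
def FlowedEnergyUVBound : Prop :=
  ∀ sch : Literature.MathematicalPhysics.QuantumFieldTheory.QCDScheme 2, sch.HasAsymptoticScaling → (∀ k, sch.mq 1 k = sch.mq 0 k) → (∀ᶠ k in Filter.atTop, -1 < sch.mq 0 k) → ∀ t : ℝ, 0 < t → ∃ C : ℝ, ∀ᶠ k in Filter.atTop, ∀ B : ℝ → Literature.MathematicalPhysics.QuantumFieldTheory.GaugeConfig 4 (sch.side k) (Matrix.specialUnitaryGroup (Fin 3) ℂ) → Literature.MathematicalPhysics.QuantumFieldTheory.GaugeConfig 4 (sch.side k) (Matrix.specialUnitaryGroup (Fin 3) ℂ), ((∀ U, B 0 U = U) ∧ ∀ (U : Literature.MathematicalPhysics.QuantumFieldTheory.GaugeConfig 4 (sch.side k) (Matrix.specialUnitaryGroup (Fin 3) ℂ)) (y : Literature.MathematicalPhysics.QuantumFieldTheory.Site 4 (sch.side k)) (μ : Fin 4) (τ : ℝ), 0 ≤ τ → ∀ i j : Fin 3, HasDerivAt (fun s : ℝ => ((B s U (y, μ) : Matrix.specialUnitaryGroup (Fin 3) ℂ) : Matrix (Fin 3) (Fin 3) ℂ) i j) ((-((fun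 W : Matrix (Fin 3) (Fin 3) ℂ => (1 / 2 : ℂ) • (W - W.conjTranspose) - ((1 / 6 : ℂ) * (W - W.conjTranspose).trace) • (1 : Matrix (Fin 3) (Fin 3) ℂ)) ((fun (V : Literature.MathematicalPhysics.QuantumFieldTheory.GaugeConfig 4 (sch.side k) (Matrix.specialUnitaryGroup (Fin 3) ℂ)) (y : Literature.MathematicalPhysics.QuantumFieldTheory.Site 4 (sch.side k)) (μ : Fin 4) => (∑ ν : Fin 4, if ν = μ then (0 : Matrix (Fin 3) (Fin 3) ℂ) else (((Literature.MathematicalPhysics.QuantumFieldTheory.plaquetteHolonomy V y μ ν : Matrix.specialUnitaryGroup (Fin 3) ℂ) : Matrix (Fin 3) (Fin 3) ℂ) + (((V (y - Pi.single ν 1, ν))⁻¹ * Literature.MathematicalPhysics.QuantumFieldTheory.plaquetteHolonomy V (y - Pi.single ν 1) ν μ * V (y - Pi.single ν 1, ν) : Matrix.specialUnitaryGroup (Fin 3) ℂ) : Matrix (Fin 3) (Fin 3) ℂ)))) (B τ U) y μ)) * ((B τ U (y, μ) : Matrix.specialUnitaryGroup (Fin 3) ℂ) : Matrix (Fin 3)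 (Fin 3) ℂ)) i j) τ) → ‖Literature.MathematicalPhysics.QuantumFieldTheory.qcdTorusExpect (sch.β k) (sch.side k) (fun f => sch.mq f k) (fun U => algebraMap ℂ (Literature.MathematicalPhysics.QuantumFieldTheory.FermiAlg 2 (sch.side k)) (((∑ μ : Fin 4, ∑ ν : Fin 4, if μ < ν then (3 - (((Literature.MathematicalPhysics.QuantumFieldTheory.plaquetteHolonomy (B (t / sch.a k ^ 2) U) 0 μ ν : Matrix.specialUnitaryGroup (Fin 3) ℂ) : Matrix (Fin 3) (Fin 3) ℂ)).trace.re) else 0) : ℝ) : ℂ))‖ ≤ C * sch.a k ^ 4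

/-- item stmt-QuantumFields-8922 · crux · rank 4 · open · by planner
why it might fail: Contains the weak-coupling lattice YM gap for ALL local observables uniformly in volume (unproved; invisible to any expansion in g) + decoupling of heavy physical quarks (a·m_f→0, κ→1/8: beyond the hopping expansion; fermionic multiscale control never done); exotic calibrations in 𝒞 to be absorbed.
sources: JaffeWitten2000, Seiler1982, OsterwalderSeiler1978, SharpeSingleton1998, AppelquistCarazzone1975, BrunoEtAl2015HeavySea
[crux] (Imported infrared half, heavy-threshold form on the interface class.) For N_f = 2, 3 and
every existence-half calibration reg ∈ 𝒞 (hypothesis = the matrix of FlowedExistenceHalf for this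
reg) there is a threshold M such that for every mass tuple with all m_f > M the lattice theory at
the scheme's own couplings β_k and bare masses m_crit(k) + a_k m_f/Z_m(k) has a uniform
full-spectrum lattice gap: ∃ Δ > 0, (reg.scheme m 0 0).HasLatticeMassGap Δ (all gauge-invariant
local lattice QCD observables, uniformly in the volume). Membership in 𝒞 pins m_crit to the true
critical region up to a bounded physical offset (dynamical quarks for all m > 0 exclude cutoff-scale
offsets), so above threshold all quarks are heavy relative to Λ and the content is "Yang–Mills
lattice gap + decoupling" — the companion cards' business (heavy-threshold-robust-ym-bridge),
deliberately ranked last here. [deps: FlowedExistenceHalf] [difficulty: open-problem] -/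
@[route_item "route-QuantumFields-GradientFlowSpecies"]
def MassiveLatticeGap : Prop :=
  ∀ Nf : ℕ, Nf = 2 ∨ Nf = 3 → ∀ reg : Literature.MathematicalPhysics.QuantumFieldTheory.QCDRegularisation Nf, (reg.HasMassScaling ∧ ∀ m : Fin Nf → ℝ, (∀ f, 0 < m f) → ∃ (z shift : Literature.MathematicalPhysics.QuantumFieldTheory.QCDField Nf → ℕ → ℝ) (T : Literature.MathematicalPhysics.QuantumFieldTheory.OSData (Literature.MathematicalPhysics.QuantumFieldTheory.QCDField Nf) 4), Literature.MathematicalPhysics.QuantumFieldTheory.IsQCDAlong (reg.scheme m z shift) T ∧ T.IsNontrivial Literature.MathematicalPhysics.QuantumFieldTheory.QCDField.glue ∧ T.IsNonGaussian Literature.MathematicalPhysics.QuantumFieldTheory.QCDField.glue ∧ ∀ f g : Fin Nf, f ≠ g → T.IsNontrivial (Literature.MathematicalPhysics.QuantumFieldTheory.QCDField.pseudoRe f g)) → ∃ M : ℝ, ∀ m : Fin Nf → ℝ, (∀ f, M < m f) → ∃ Δ : ℝ, 0 < Δ ∧ (reg.scheme m 0 0).HasLatticeMassGap Δ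

/-- item stmt-QuantumFields-8923 · support · rank 9 · open · by planner
sources: Luscher1977, OsterwalderSeiler1978, GlimmJaffe1987, Seiler1982
[support] Uniform lattice gap + convergence ⇒ continuum gap: if IsQCDAlong sch T and
sch.HasLatticeMassGap Δ then T.HasMassGap Δ' for every 0 < Δ' < Δ. Route: at fixed k let the time
extent S → ∞ (allowed by HasLatticeMassGap's volume-uniformity) and read the pairwise bounds
spectrally through Lüscher's positive transfer matrix for Wilson fermions (m_f(k) > −1): every
vector ÂΩ has spectral measure in {1} ∪ [0, e^(−aΔ)], these span the physical space, hence ‖Tⁿ −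
P_Ω‖ ≤ e^(−aΔn) with constant 1; apply to time-ordered products of smeared species fields (constants
= norms = reflection-positive 2n-point functions, convergent by IsQCDAlong), pass k → ∞, extend from
product tensors by E0' linear growth. Glue, but with two honest gaps: finite-torus (−1)^F-twisted
trace vs vacuum expectation at fixed k, and S → ∞ before k → ∞. [difficulty: M] -/
@[route_item "route-QuantumFields-GradientFlowSpecies"]
def GapTransfer : Prop :=
  ∀ (Nf : ℕ) (sch : Literature.MathematicalPhysics.QuantumFieldTheory.QCDScheme Nf) (T : Literature.MathematicalPhysics.QuantumFieldTheory.OSData (Literature.MathematicalPhysics.QuantumFieldTheory.QCDField Nf) 4) (Δ Δ' : ℝ), 0 < Δ' → Δ' < Δ → Literature.MathematicalPhysics.QuantumFieldTheory.IsQCDAlong sch T → sch.HasLatticeMassGap Δ → T.HasMassGap Δ'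

/-- item stmt-QuantumFields-8924 · support · rank 9 · closed · proved by Summit.QuantumFields.QCD.Theorems.offsetShift_proof @ 3ff91cca4fa0 (prover) · by planner
sources: MontvayMunster1994
[support] The offset trick used by the Assembly: shifting the critical mass of a regularisation by
a_k·M/Z_m(k) realises the mass tuple m as the original regularisation realises m + M (definitional:
both schemes have bare masses m_crit(k) + a_k(m_f + M)/Z_m(k); HasMassScaling is untouched since Z_m
is). Provable now (structure eta + ring). [difficulty: provable-now] -/
@[route_item "route-QuantumFields-GradientFlowSpecies"]
def OffsetShift : Prop :=
  ∀ (Nf : ℕ) (reg : Literature.MathematicalPhysics.QuantumFieldTheory.QCDRegularisation Nf) (M : ℝ) (m : Fin Nf → ℝ) (z shift : Literature.MathematicalPhysics.QuantumFieldTheory.QCDField Nf → ℕ → ℝ), ({ reg with mcrit := fun k => reg.mcrit k + reg.a k * M / reg.Zm k } : Literature.MathematicalPhysics.QuantumFieldTheory.QCDRegularisation Nf).scheme m z shift = reg.scheme (fun f => m f + M) z shift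

-- `OffsetShift` holds: proved by `Summit.QuantumFields.QCD.Theorems.offsetShift_proof` @ 3ff91cca4fa0 (its module imports this route file, so no `_holds` link can be stated here).

/-- item stmt-QuantumFields-8925 · support · rank 9 · open · by planner
sources: Hamilton1993, ChenShen1994, Struwe1994, Waldron2019, Luscher2010
[support] (Deterministic half of FlowedEnergyUVBound: lattice ε-regularity for the Wilson flow,
uniform in the flow time.) There are ε₀ > 0 and C such that on every torus (ℤ/S)⁴, for every
solution B of Lüscher's lattice flow ODE (inlined as in FlowedEnergyUVBound), every configuration U,
site x, plane (μ,ν) and lattice flow time 1 ≤ t ≤ S²/64: if the Gaussian-weighted plaquette action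
at scale √t, Ψ(x,t,U) = Σ_p exp(−dist(x,p)²/4t)(3 − Re tr U_p) (torus distance), is ≤ ε₀, then the
flowed plaquette at x obeys 3 − Re tr (B_t U)_p(x;μ,ν) ≤ C/t². Continuum model: Hamilton's
monotonicity of the Gaussian-weighted Yang–Mills energy in d = 4 + Chen–Shen small-action
regularity; applied at time t/2 → t to already-flowed fields it converts "small flowed action
density with high probability" into pointwise O(a⁴) bounds. A linear refinement (≤ C·Ψ/t²) is
expected but not filed. [difficulty: L] -/
@[route_item "route-QuantumFields-GradientFlowSpecies"]
def LatticeFlowEpsilonRegularity : Prop :=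
  ∃ ε₀ : ℝ, 0 < ε₀ ∧ ∃ C : ℝ, ∀ (S : ℕ) [NeZero S] (B : ℝ → Literature.MathematicalPhysics.QuantumFieldTheory.GaugeConfig 4 S (Matrix.specialUnitaryGroup (Fin 3) ℂ) → Literature.MathematicalPhysics.QuantumFieldTheory.GaugeConfig 4 S (Matrix.specialUnitaryGroup (Fin 3) ℂ)), ((∀ U, B 0 U = U) ∧ ∀ (U : Literature.MathematicalPhysics.QuantumFieldTheory.GaugeConfig 4 S (Matrix.specialUnitaryGroup (Fin 3) ℂ)) (y : Literature.MathematicalPhysics.QuantumFieldTheory.Site 4 S) (μ : Fin 4) (τ : ℝ), 0 ≤ τ → ∀ i j : Fin 3, HasDerivAt (fun s : ℝ => ((B s U (y, μ) : Matrix.specialUnitaryGroup (Fin 3) ℂ) : Matrix (Fin 3) (Fin 3) ℂ) i j) ((-((fun W : Matrix (Fin 3) (Fin 3) ℂ => (1 / 2 : ℂ) • (W - W.conjTranspose) - ((1 / 6 : ℂ) * (W - W.conjTranspose).trace) • (1 : Matrix (Fin 3) (Fin 3) ℂ)) ((fun (V : Literature.MathematicalPhysics.QuantumFieldTheory.GaugeConfig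 4 S (Matrix.specialUnitaryGroup (Fin 3) ℂ)) (y : Literature.MathematicalPhysics.QuantumFieldTheory.Site 4 S) (μ : Fin 4) => (∑ ν : Fin 4, if ν = μ then (0 : Matrix (Fin 3) (Fin 3) ℂ) else (((Literature.MathematicalPhysics.QuantumFieldTheory.plaquetteHolonomy V y μ ν : Matrix.specialUnitaryGroup (Fin 3) ℂ) : Matrix (Fin 3) (Fin 3) ℂ) + (((V (y - Pi.single ν 1, ν))⁻¹ * Literature.MathematicalPhysics.QuantumFieldTheory.plaquetteHolonomy V (y - Pi.single ν 1) ν μ * V (y - Pi.single ν 1, ν) : Matrix.specialUnitaryGroup (Fin 3) ℂ) : Matrix (Fin 3) (Fin 3) ℂ)))) (B τ U) y μ)) * ((B τ U (y, μ) : Matrix.specialUnitaryGroup (Fin 3) ℂ) : Matrix (Fin 3) (Fin 3) ℂ)) i j) τ) → ∀ (U : Literature.MathematicalPhysics.QuantumFieldTheory.GaugeConfig 4 S (Matrix.specialUnitaryGroup (Fin 3) ℂ)) (x : Literature.MathematicalPhysics.QuantumFieldTheory.Site 4 S) (μ ν : Fin 4) (t : ℝ), 1 ≤ t → 64 * t ≤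 (S : ℝ) ^ 2 → (∑ y : Literature.MathematicalPhysics.QuantumFieldTheory.Site 4 S, ∑ μ' : Fin 4, ∑ ν' : Fin 4, if μ' < ν' then Real.exp (-(∑ i : Fin 4, ((min ((x i - y i).val) (S - (x i - y i).val) : ℕ) : ℝ) ^ 2) / (4 * t)) * (3 - (((Literature.MathematicalPhysics.QuantumFieldTheory.plaquetteHolonomy U y μ' ν' : Matrix.specialUnitaryGroup (Fin 3) ℂ) : Matrix (Fin 3) (Fin 3) ℂ)).trace.re) else 0) ≤ ε₀ → (3 - (((Literature.MathematicalPhysics.QuantumFieldTheory.plaquetteHolonomy (B t U) x μ ν : Matrix.specialUnitaryGroup (Fin 3) ℂ) : Matrix (Fin 3) (Fin 3) ℂ)).trace.re) ≤ C / t ^ 2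

/-- item stmt-QuantumFields-8926 · assembly · rank 1 · open · by planner
sources: JaffeWitten2000, MontvayMunster1994
[assembly] FlowedExistenceHalf → MassiveLatticeGap → GapTransfer → QCD (OffsetShift is used inside
the proof and is provable outright). -/
@[route_item "route-QuantumFields-GradientFlowSpecies"]
def Assembly : Prop :=
  FlowedExistenceHalf → MassiveLatticeGap → GapTransfer → QCD

/-! D-0027 §2.1 — DECIDING THEOREM (planner-authored via `route open/edit --closes-file`; by planner-plancard-QuantumFields-QCD-gradient-f-c9df0611-0 2026-08-15T13:58:10Z):
its hypotheses are this route's items and its conclusion the sub-problem Statement (glue_lint), and it elaborates with this file. -/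

@[closes "route-QuantumFields-GradientFlowSpecies"] theorem closes : FlowedExistenceHalf → MassiveLatticeGap → GapTransfer → QCD := by
  intro hA hB hT
  have key : ∀ Nf : ℕ, (Nf = 2 ∨ Nf = 3) → QCDOf Nf := by
    intro Nf hNf
    obtain ⟨reg, hreg⟩ := hA Nf hNf
    obtain ⟨M, hM⟩ := hB Nf hNf reg hreg
    obtain ⟨hms, hbody⟩ := hreg
    set M' : ℝ := max M 0 + 1 with hM'def
    have hM'pos : 0 < M' := by
      have := le_max_right M 0
      linarith
    have hM'gt : M < M' := by
      have := le_max_left M 0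
      linarith
    let reg' : Literature.MathematicalPhysics.QuantumFieldTheory.QCDRegularisation Nf :=
      { reg with mcrit := fun k => reg.mcrit k + reg.a k * M' / reg.Zm k }
    have hsch : ∀ (m : Fin Nf → ℝ) (z shift : Literature.MathematicalPhysics.QuantumFieldTheory.QCDField Nf → ℕ → ℝ),
        reg'.scheme m z shift = reg.scheme (fun f => m f + M') z shift := by
      intro m z shift
      simp only [Literature.MathematicalPhysics.QuantumFieldTheory.QCDRegularisation.scheme, reg']
      congr 1
      funext f k
      ring
    have hgapEq : ∀ (m : Fin Nf → ℝ) (z shift : Literature.MathematicalPhysics.QuantumFieldTheory.QCDField Nf → ℕ → ℝ) (Δ : ℝ),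
        (reg.scheme m z shift).HasLatticeMassGap Δ ↔ (reg.scheme m 0 0).HasLatticeMassGap Δ := by
      intro m z shift Δ
      rfl
    have hmono : ∀ (sch : Literature.MathematicalPhysics.QuantumFieldTheory.QCDScheme Nf) (Δ Δ' : ℝ), Δ' ≤ Δ →
        sch.HasLatticeMassGap Δ → sch.HasLatticeMassGap Δ' := by
      intro sch Δ Δ' hle h R R' A B
      obtain ⟨C, hC⟩ := h R R' A B
      refine ⟨max C 0, ?_⟩
      filter_upwards [hC] with k hk S hS n hn
      have h1 := hk S hS n hn
      have hexp : Real.exp (-(Δ * (sch.a k * n))) ≤ Real.exp (-(Δ' * (sch.a k * n))) := by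
        apply Real.exp_le_exp.mpr
        have han : 0 ≤ sch.a k * n := mul_nonneg (sch.a_pos k).le (Nat.cast_nonneg n)
        nlinarith
      calc ‖Literature.MathematicalPhysics.QuantumFieldTheory.qcdLatticeConnectedCorr (sch.β k) (2 * S + 1) (fun fl => sch.mq fl k) A B n‖
          ≤ C * Real.exp (-(Δ * (sch.a k * n))) := h1
        _ ≤ max C 0 * Real.exp (-(Δ * (sch.a k * n))) :=
            mul_le_mul_of_nonneg_right (le_max_left C 0) (Real.exp_pos _).le
        _ ≤ max C 0 * Real.exp (-(Δ' * (sch.a k * n))) :=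
            mul_le_mul_of_nonneg_left hexp (le_max_right C 0)
    refine ⟨reg', hms, fun m hm => ?_⟩
    have hm' : ∀ f, 0 < m f + M' := fun f => by
      have := hm f
      linarith
    have hmM : ∀ f, M < (fun f => m f + M') f := fun f => by
      have := hm f
      show M < m f + M'
      linarith
    obtain ⟨z, shift, T, hqcd, hnt, hng, hdyn⟩ := hbody (fun f => m f + M') hm'
    obtain ⟨Δ, hΔ, hgap⟩ := hM (fun f => m f + M') hmM
    have hgap' : (reg.scheme (fun f => m f + M') z shift).HasLatticeMassGap Δ :=
      (hgapEq _ z shift Δ).mpr hgap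
    have hcont : T.HasMassGap (Δ / 2) :=
      hT Nf _ T Δ (Δ / 2) (by positivity) (by linarith) hqcd hgap'
    refine ⟨z, shift, T, ?_, hnt, hng, hdyn, Δ / 2, by positivity, hcont, ?_⟩
    · rw [hsch]; exact hqcd
    · rw [hsch]; exact hmono _ Δ (Δ / 2) (by linarith) hgap'
  exact ⟨key 2 (Or.inl rfl), key 3 (Or.inr rfl)⟩

end Summit.QuantumFields.QCD.Theses.GradientFlowSpecies
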